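import Summits.AtomisticToContinuum.BoseEinsteinCondensation.Theses.BECHusimiAmplitudeGas
import Summits.AtomisticToContinuum.BoseEinsteinCondensation.Theorems.BECHusimiAmplitudeGasPositivityReductionStability
import Summits.AtomisticToContinuum.BoseEinsteinCondensation.Theorems.BECHusimiAmplitudeGasPositivityReductionModulus
import HarnessLib

/-!
# Route BECHusimiAmplitudeGas — `PositivityReduction` (item stmt-AtomisticToContinuum-11998), part 3:
# the positivity reduction for bounded pair potentials

`PositivityReduction` asks: constant-mode BEC for the NONNEGATIVE periodic near-minimisers
(`PeriodicBECNonneg`) implies constant-mode BEC for ALL periodic near-minimisers (the hypothesis of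
`BoundaryTransferWeak`), for every repulsive finite-range pair potential `v`. This file proves it
for every measurable finite-range `v` that is BOUNDED (`v ≤ M < ∞`; no hard core), which is exactly
the class on which the tree knows that the periodic `N`-boson ground state is nondegenerate
(`Literature.MathematicalPhysics.QuantumManyBody.PeriodicGroundStateNondegenerate_holds`,
Reed–Simon IV §XIII.12):

* `exists_nonneg_nearMinimiser` — for bounded `v`, `N ≥ 1`, `L > 0` and every `δ > 0` there is a
  pointwise nonnegative periodic `C¹` Bose trial state with `periodicEnergy ≤ E₀ + δ` (regularised
  modulus `Z⁻¹√(|Ψ|²+η²)` of a `δ/2`-near-minimiser, part 2, with `η²∫W < δ/2`);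
* `periodicBEC_of_periodicBECNonneg_of_bounded` — at one bounded `v`: if for `ρ < ρ₀`, some `c > 0`,
  all large `N` and some `δ₁ > 0` every NONNEGATIVE `δ₁`-near-minimiser has `n₀ ≥ cN`, then for the
  same `ρ₀`, with `c/2`, all large `N` and `δ = min δ₁ δ₂` EVERY `δ`-near-minimiser has `n₀ ≥ (c/2)N`:
  fire the hypothesis on a nonnegative `δ`-near-minimiser `Φ₊` and transfer to an arbitrary
  `δ`-near-minimiser `Ψ` by the two-near-minimiser stability `n₀(Φ₊) ≤ n₀(Ψ) + (c/2)N` (part 1,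
  `δ₂ = δ₂(c/2)` from the spectral gap at fixed `N`);
* `positivityReduction_of_bounded` — the item's implication `PeriodicBECNonneg → …` with the single
  extra hypothesis `∃ M : ℝ≥0, ∀ r, v r ≤ M` on the potential.

What is NOT here: hard cores / unbounded `v` (the item as filed quantifies over all
`IsRepulsiveFiniteRange v`). There the transfer needs the nondegeneracy (uniqueness) of the periodic
ground state for potentials taking the value `⊤`, i.e. connectedness of the dilute hard-sphere
configuration space on the torus and a Perron–Frobenius theorem for the Dirichlet form on it — not in
the tree and, for hard spheres on the torus at these densities, not in print (the route's own recorded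
caveat; cf. crux `HardCoreExtension` of route `BECConjugateDomination`).
-/

noncomputable section

open MeasureTheory Filter Set Complex
open scoped ENNReal NNReal Topology ComplexConjugate

namespace Summit.AtomisticToContinuum.BoseEinsteinCondensation.Theorems

open Literature.MathematicalPhysics.QuantumManyBody.BoseGas Literature.Analysis.InnerProduct
  Literature.MathematicalPhysics.QuantumManyBody

/-! ### Nonnegative near-minimisers exist at every slack -/

/-- **Nonnegative near-minimisers exist** (bounded pair potentials). For a measurable, bounded,
finite-range `v`, `N ≥ 1`, `L > 0` and `δ > 0` there is a periodic `C¹` Bose trial state `Φ` which is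
pointwise a nonnegative real and has `periodicEnergy v Φ ≤ periodicGroundStateEnergy v N L + δ`:
the ground-state energy is finite (min–max, `W ∈ L¹`), so a `δ/2`-near-minimiser `Ψ` exists, and its
regularised modulus `Z⁻¹√(|Ψ|² + η²)` with `η² ∫_cell W < δ/2` (`exists_regularisedModulus`) does it.
[folklore] -/
theorem exists_nonneg_nearMinimiser {v : ℝ → ℝ≥0∞} (hmeas : Measurable v) {R₀ : ℝ}
    (hR₀ : ∀ r, R₀ < r → v r = 0) {M : ℝ≥0} (hM : ∀ r, v r ≤ M) {N : ℕ} (hN : 0 < N) {L : ℝ}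
    (hL : 0 < L) {δ : ℝ≥0∞} (hδ : 0 < δ) :
    ∃ Φ : PeriodicTrialState N L, (∀ X, Φ.ψ X = ((‖Φ.ψ X‖ : ℝ) : ℂ)) ∧
      periodicEnergy v Φ ≤ periodicGroundStateEnergy v N L + δ := by
  -- bounded periodisation, `W ∈ L¹(cell)`, finite ground-state energy
  obtain ⟨C, hC⟩ := exists_bound_periodizedPotential hL hM hR₀
  have hW : ∫⁻ X in cellN N L, periodicInteraction v L X ≠ ⊤ :=
    lintegral_periodicInteraction_ne_top hC N
  obtain ⟨d⟩ := nonempty_twoModeData hL hmeas hW hN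
  have hE₀ : periodicGroundStateEnergy v N L ≠ ⊤ := by
    rw [periodicGroundStateEnergy_eq_ofReal d]
    exact ENNReal.ofReal_ne_top
  -- a `δ/2`-near-minimiser
  have hδ2 : δ / 2 ≠ 0 := (ENNReal.half_pos hδ.ne').ne'
  obtain ⟨Ψ, hΨ⟩ : ∃ Ψ : PeriodicTrialState N L,
      periodicEnergy v Ψ < periodicGroundStateEnergy v N L + δ / 2 :=
    iInf_lt_iff.1 (ENNReal.lt_add_right hE₀ hδ2)
  -- the regularisation parameter: `η² ∫W < δ/2`
  obtain ⟨n, hn0, hn⟩ := ENNReal.exists_nnreal_pos_mul_lt hW hδ2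
  set η : ℝ := Real.sqrt n with hη
  have hη0 : 0 < η := Real.sqrt_pos.2 (by exact_mod_cast hn0)
  have hη2 : ENNReal.ofReal (η ^ 2) = (n : ℝ≥0∞) := by
    rw [hη, Real.sq_sqrt n.coe_nonneg, ENNReal.ofReal_coe_nnreal]
  obtain ⟨Φ, -, hΦnn, hΦE⟩ := exists_regularisedModulus hL Ψ hη0
  refine ⟨Φ, hΦnn, ?_⟩
  calc periodicEnergy v Φ
      ≤ periodicEnergy v Ψ + ENNReal.ofReal (η ^ 2) * ∫⁻ X in cellN N L, periodicInteraction v L X :=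
        hΦE v hmeas
    _ ≤ (periodicGroundStateEnergy v N L + δ / 2) + δ / 2 := by
        rw [hη2]
        exact add_le_add hΨ.le hn.le
    _ = periodicGroundStateEnergy v N L + δ := by rw [add_assoc, ENNReal.add_halves]

/-! ### The reduction at one bounded potential -/

/-- **Positivity reduction at a bounded potential.** Let `v` be measurable, bounded and of finite
range, and `ρ₀ > 0`. Suppose that for every `0 < ρ < ρ₀` there is `c > 0` such that for all large `N`
some `δ > 0` makes every NONNEGATIVE periodic `δ`-near-minimiser `Ψ` on the torus of side
`L = (N/ρ)^{1/3}` satisfy `n₀(Ψ) ≥ cN`. Then the same holds (with `c/2`) for ALL periodic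
near-minimisers. Proof at fixed large `N`: with `δ₁` from the hypothesis and `δ₂ = δ₂(c/2)` from the
two-near-minimiser stability (`condensateOccupation_le_of_nearMinimisers`), put `δ = min δ₁ δ₂`;
a nonnegative `δ`-near-minimiser `Φ₊` exists (`exists_nonneg_nearMinimiser`), has `n₀(Φ₊) ≥ cN`,
and `n₀(Φ₊) ≤ n₀(Ψ) + (c/2)N` for every `δ`-near-minimiser `Ψ`. [folklore] -/
theorem periodicBEC_of_periodicBECNonneg_of_bounded {v : ℝ → ℝ≥0∞} (hv : IsRepulsiveFiniteRange v)
    (hbdd : ∃ M : ℝ≥0, ∀ r, v r ≤ M) {ρ₀ : ℝ}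
    (hnn : ∀ ρ : ℝ, 0 < ρ → ρ < ρ₀ → ∃ c : ℝ, 0 < c ∧ ∀ᶠ N : ℕ in Filter.atTop, ∃ δ : ℝ≥0∞, 0 < δ ∧
      ∀ Ψ : PeriodicTrialState N (sideLength ρ N),
        periodicEnergy v Ψ ≤ periodicGroundStateEnergy v N (sideLength ρ N) + δ →
        (∀ X, Ψ.ψ X = ((‖Ψ.ψ X‖ : ℝ) : ℂ)) →
        ENNReal.ofReal (c * N) ≤ condensateOccupation N (sideLength ρ N) Ψ.ψ) :
    ∀ ρ : ℝ, 0 < ρ → ρ < ρ₀ → ∃ c : ℝ, 0 < c ∧ ∀ᶠ N : ℕ in Filter.atTop, ∃ δ : ℝ≥0∞, 0 < δ ∧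
      ∀ Ψ : PeriodicTrialState N (sideLength ρ N),
        periodicEnergy v Ψ ≤ periodicGroundStateEnergy v N (sideLength ρ N) + δ →
        ENNReal.ofReal (c * N) ≤ condensateOccupation N (sideLength ρ N) Ψ.ψ := by
  obtain ⟨hmeas, R₀, hR₀⟩ := hv
  obtain ⟨M, hM⟩ := hbdd
  intro ρ hρ hρlt
  obtain ⟨c, hc, hev⟩ := hnn ρ hρ hρlt
  refine ⟨c / 2, half_pos hc, ?_⟩
  filter_upwards [hev, eventually_gt_atTop 0] with N hN hN0
  obtain ⟨δ₁, hδ₁, hnonneg⟩ := hN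
  -- the side of the torus
  have hL : 0 < sideLength ρ N :=
    Real.rpow_pos_of_pos (div_pos (Nat.cast_pos.2 hN0) hρ) _
  -- stability with `ε = c/2`
  obtain ⟨δ₂, hδ₂, hstab⟩ :=
    condensateOccupation_le_of_nearMinimisers hmeas hR₀ hM N hL (half_pos hc)
  refine ⟨min δ₁ δ₂, lt_min hδ₁ hδ₂, fun Ψ hΨ => ?_⟩
  -- a nonnegative `δ`-near-minimiser, on which the hypothesis fires
  obtain ⟨Φ, hΦnn, hΦE⟩ := exists_nonneg_nearMinimiser hmeas hR₀ hM hN0 hL (lt_min hδ₁ hδ₂)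
  have h1 : ENNReal.ofReal (c * N) ≤ condensateOccupation N (sideLength ρ N) Φ.ψ :=
    hnonneg Φ (hΦE.trans (add_le_add le_rfl (min_le_left _ _))) hΦnn
  -- transfer to `Ψ`
  have h2 : condensateOccupation N (sideLength ρ N) Φ.ψ ≤
      condensateOccupation N (sideLength ρ N) Ψ.ψ + ENNReal.ofReal (c / 2 * N) :=
    hstab Φ Ψ (hΦE.trans (add_le_add le_rfl (min_le_right _ _)))
      (hΨ.trans (add_le_add le_rfl (min_le_right _ _)))
  have hsplit : ENNReal.ofReal (c * N) = ENNReal.ofReal (c / 2 * N) + ENNReal.ofReal (c / 2 * N) := by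
    rw [← ENNReal.ofReal_add (by positivity) (by positivity)]
    congr 1
    ring
  rw [hsplit] at h1
  exact ENNReal.le_of_add_le_add_right ENNReal.ofReal_ne_top (h1.trans h2)

/-! ### The item's implication, for bounded potentials -/

/-- **`PositivityReduction` for bounded pair potentials** (item stmt-AtomisticToContinuum-11998 of
route `BECHusimiAmplitudeGas`, restricted form). `PeriodicBECNonneg` (constant-mode BEC for the
nonnegative periodic near-minimisers, for every admissible `v`) implies, for every measurable
finite-range `v` which is moreover BOUNDED (`∃ M : ℝ≥0, v ≤ M`), the body of the hypothesis of
`BoundaryTransferWeak`: `∃ ρ₀ > 0, ∀ ρ ∈ (0, ρ₀), ∃ c > 0, ∀ᶠ N, ∃ δ > 0`, every periodic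
`δ`-near-minimiser `Ψ` on the torus of side `(N/ρ)^{1/3}` has `condensateOccupation ≥ cN`. This is
the item's statement with the single extra hypothesis of boundedness of `v` (the hard-core /
unbounded case needs the nondegeneracy of the periodic ground state for such potentials, absent from
the tree). [folklore] -/
theorem positivityReduction_of_bounded
    (hBEC : Summit.AtomisticToContinuum.BoseEinsteinCondensation.Theses.BECHusimiAmplitudeGas.PeriodicBECNonneg) :
    ∀ v : ℝ → ENNReal, Literature.MathematicalPhysics.QuantumManyBody.BoseGas.IsRepulsiveFiniteRange v →
      (∃ M : ℝ≥0, ∀ r, v r ≤ M) →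
      ∃ ρ₀ : ℝ, 0 < ρ₀ ∧ ∀ ρ : ℝ, 0 < ρ → ρ < ρ₀ → ∃ c : ℝ, 0 < c ∧ ∀ᶠ N : ℕ in Filter.atTop,
        ∃ δ : ENNReal, 0 < δ ∧ ∀ Ψ : Literature.MathematicalPhysics.QuantumManyBody.BoseGas.PeriodicTrialState N
          (Literature.MathematicalPhysics.QuantumManyBody.BoseGas.sideLength ρ N),
          Literature.MathematicalPhysics.QuantumManyBody.BoseGas.periodicEnergy v Ψ ≤
            Literature.MathematicalPhysics.QuantumManyBody.BoseGas.periodicGroundStateEnergy v N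
              (Literature.MathematicalPhysics.QuantumManyBody.BoseGas.sideLength ρ N) + δ →
          ENNReal.ofReal (c * N) ≤
            Literature.MathematicalPhysics.QuantumManyBody.BoseGas.condensateOccupation N
              (Literature.MathematicalPhysics.QuantumManyBody.BoseGas.sideLength ρ N) Ψ.ψ := by
  intro v hv hbdd
  obtain ⟨ρ₀, hρ₀, H⟩ := hBEC v hv
  exact ⟨ρ₀, hρ₀, periodicBEC_of_periodicBECNonneg_of_bounded hv hbdd H⟩

end Summit.AtomisticToContinuum.BoseEinsteinCondensation.Theorems

end
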